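import Mathlib
import Literature.Analysis.FluidPDE.ClassicalSolution
import Literature.Analysis.FluidPDE.LerayHopf
import Literature.Analysis.FluidPDE.NSWave0
import Summits.NavierStokesRegularity.NavierStokesRegularity.Theses.L3TimeExponentPincer
import Summits.NavierStokesRegularity.NavierStokesRegularity.Theorems.L3TimeExponentPincerEffNode
import Summits.NavierStokesRegularity.NavierStokesRegularity.Theorems.L3TimeExponentPincerSmoothBranch
import HarnessLib

/-!
# Line `EffSat` for crux `L3CascadeJaw` (stmt-NavierStokesRegularity-19499, route `L3TimeExponentPincer`)

Birth/working skeleton of the registered line (ledger `payload.skeleton` sha 214f4e13…, p4 g0,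
2026-08-26T01:51Z; the planners' v2 file `LineEffSatV2.lean`, nsreg-p2 ROUND-6/7), republished by the
parent-crux seat ns-pincer-19499-p1 so that `Cruxes/L3CascadeJaw/Lines/` is no longer empty.  Same two
REGISTERED stubs, same namespace, same signatures:

* `stub_effSaturation_blowup` (HARD, open; verbatim the child crux `EffSatBlowup`,
  stmt-NavierStokesRegularity-19139, itself lined as `Cruxes/EffSatBlowup/Lines/pace.lean` with stubs
  `stub_morreyTypeI_slow` / `stub_morreyTypeII_fastFat`, stub 1 landed p423422): `K₃(1)` on the blow-up
  branch — every frame blow-up carries, uniformly near `T`, an `L³`-effective fat ball at the causal scale.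
* `stub_jawSmoothBranch` (CLOSED: `jawSmoothBranch_holds`, p414110; item 19140 closed) — kept as a
  registered stub, discharged here without `sorry`.
* `L3CascadeJaw_of` — the composition, concluding the route decl BY NAME from the stubs
  (`l3CascadeJaw_of_effSatBlowup`, p414110 / glue item 19141).

Status of the line (parent seat's census, 2026-08-26): sorries = 1 (= the child crux).  Known toward the open
stub, all kernel: NoTypeII (0056) ⇒ EffSatBlowup (p417356); Type-I / full-Morrey / sub-parabolic-Morrey /
weak-L³ / dissipation-rate classes satisfy the PARENT clause directly (p414909, p435650, p444229, p436632,
p442318) without passing through `K₃(1)`.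

WHAT THIS IS NOT: not a proof of `L3CascadeJaw`, not NS regularity; a skeleton whose only `sorry` is the
registered hard stub.
-/

noncomputable section

namespace Summit.NavierStokesRegularity.NavierStokesRegularity.Cruxes.L3CascadeJaw.EffSat

open MeasureTheory Set Metric
open scoped ENNReal
open Literature.Analysis.FluidPDE
open Summit.NavierStokesRegularity.NavierStokesRegularity.Theorems.L3TimeExponentPincerEffNode
open Summit.NavierStokesRegularity.NavierStokesRegularity.Theorems.L3TimeExponentPincerSmoothBranch

/-! ## Stubs (REGISTERED targets of the line) -/

/-- **stub (HARDEST, open) — `K₃(1)` on the blow-up branch** (= child crux `EffSatBlowup`,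
stmt-NavierStokesRegularity-19139, verbatim).  For every frame solution that does NOT extend smoothly past
`T`: there are `m, R₀, L > 0` and a final window on which, at each time, some `U ≥ 0` with
`‖u(t)‖₃³ ≤ L·U`, some centre `x₀` and some radius `r ≥ R₀ · U · (T - t)` satisfy
`m U² r³ ≤ ∫_{B(x₀,r)} |u(t)|²`.  Why it might fail: a true-NS blow-up driven by a sub-Euler-paced
cascade (κ-damped class, realisable in Tao-averaged equations) violates it. -/
theorem stub_effSaturation_blowup :
    ∀ (ν T : ℝ), 0 < ν → 0 < T → ∀ (u : ℝ → (EuclideanSpace ℝ (Fin 3)) → (EuclideanSpace ℝ (Fin 3))) (p : ℝ → (EuclideanSpace ℝ (Fin 3)) → ℝ),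
      IsClassicalNSSolutionOn (Ico 0 T) ν 0 u p → IsLerayHopfOn T ν 0 (u 0) u →
      HasRapidSpatialDecay (u 0) → ¬ HasSmoothExtensionPast ν 0 u T →
      ∃ m : ℝ, 0 < m ∧ ∃ R₀ : ℝ, 0 < R₀ ∧ ∃ L : ℝ, 0 < L ∧ ∃ T₁ < T, ∀ t ∈ Ioo T₁ T,
        ∃ U : ℝ, 0 ≤ U ∧ eLpNorm (u t) 3 volume ^ (3 : ℝ) ≤ ENNReal.ofReal (L * U) ∧
          ∃ x₀ : (EuclideanSpace ℝ (Fin 3)), ∃ r : ℝ, R₀ * U * (T - t) ≤ r ∧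
            ENNReal.ofReal (m * (U ^ 2 * r ^ 3)) ≤ ∫⁻ x in ball x₀ r, ‖u t x‖ₑ ^ 2 := by
  sorry

/-- **stub (CLOSED) — the jaw on the smooth-past-`T` branch** (= item 19140 `JawSmoothBranch`, verbatim):
a frame solution that extends smoothly past `T` has `∫_{T₂}^T ‖u(t)‖₃^q dt < ∞` for every `q ∈ (4,5)` on
some final window.  Discharged by `jawSmoothBranch_holds` (Theorems/L3TimeExponentPincerSmoothBranch). -/
theorem stub_jawSmoothBranch :
    ∀ q : ℝ, 4 < q → q < 5 → ∀ (ν T : ℝ), 0 < ν → 0 < T → ∀ (u : ℝ → (EuclideanSpace ℝ (Fin 3)) → (EuclideanSpace ℝ (Fin 3))) (p : ℝ → (EuclideanSpace ℝ (Fin 3)) → ℝ),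
      IsClassicalNSSolutionOn (Ico 0 T) ν 0 u p → IsLerayHopfOn T ν 0 (u 0) u →
      HasRapidSpatialDecay (u 0) → HasSmoothExtensionPast ν 0 u T →
      ∃ T₂ ∈ Ioo 0 T, (∫⁻ t in Ioo T₂ T, eLpNorm (u t) 3 volume ^ q) < ⊤ :=
  jawSmoothBranch_holds

/-! ## Composition (PROVED): the stubs imply the crux BY NAME -/

/-- The line closes the crux modulo its stubs: `stub_effSaturation_blowup` (and the closed
`stub_jawSmoothBranch`) give `L3CascadeJaw` by the landed one-stub composition
`l3CascadeJaw_of_effSatBlowup`. -/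
theorem L3CascadeJaw_of :
    Summit.NavierStokesRegularity.NavierStokesRegularity.Theses.L3TimeExponentPincer.L3CascadeJaw :=
  l3CascadeJaw_of_effSatBlowup stub_effSaturation_blowup

/-- The registered hard stub IS the child crux `EffSatBlowup` (definitional unfolding). -/
theorem stub_effSaturation_blowup_iff_child :
    (∀ (ν T : ℝ), 0 < ν → 0 < T → ∀ (u : ℝ → (EuclideanSpace ℝ (Fin 3)) → (EuclideanSpace ℝ (Fin 3)))
        (p : ℝ → (EuclideanSpace ℝ (Fin 3)) → ℝ),
      IsClassicalNSSolutionOn (Ico 0 T) ν 0 u p → IsLerayHopfOn T ν 0 (u 0) u →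
      HasRapidSpatialDecay (u 0) → ¬ HasSmoothExtensionPast ν 0 u T →
      ∃ m : ℝ, 0 < m ∧ ∃ R₀ : ℝ, 0 < R₀ ∧ ∃ L : ℝ, 0 < L ∧ ∃ T₁ < T, ∀ t ∈ Ioo T₁ T,
        ∃ U : ℝ, 0 ≤ U ∧ eLpNorm (u t) 3 volume ^ (3 : ℝ) ≤ ENNReal.ofReal (L * U) ∧
          ∃ x₀ : (EuclideanSpace ℝ (Fin 3)), ∃ r : ℝ, R₀ * U * (T - t) ≤ r ∧
            ENNReal.ofReal (m * (U ^ 2 * r ^ 3)) ≤ ∫⁻ x in ball x₀ r, ‖u t x‖ₑ ^ 2) ↔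
    Summit.NavierStokesRegularity.NavierStokesRegularity.Theses.L3TimeExponentPincer.EffSatBlowup :=
  Iff.rfl

end Summit.NavierStokesRegularity.NavierStokesRegularity.Cruxes.L3CascadeJaw.EffSat

end
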